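import Summits.BirchSwinnertonDyer.BirchSwinnertonDyer.Theorems.KimAtThreeShallowEqDeepMultTwoExpPort
import HarnessLib

/-!
# Route `KimAtThreeKolyvagin` (W2): the two-exponent off-stratum port on the NON-ADDITIVE non-anomalous rows
# (split-multiplicative `3 ∣ c₃` INCLUDED) FROM THE FINE KATO PACKAGE (C1′₂) AND NON-ANOMALY ALONE, and the
# SHALLOW = DEEP / LEAF / LOWER row conclusions of cruxes 19599 / 19077 / 19679 there from PUB + (C1′₂)

Cell `bsd-addord`, seat `bsd-addord-w2-c4` (gen 10; owner of crux 19599 `ShallowEqDeepOffKatoStratum`, item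
19077 `ShallowEqDeepAtTorsionFree`).  `--supports` 19599.  HONEST FRAMING: END THEOREMS WITH DISPLAYED
HYPOTHESES (no definition, no named fact, no instance, no `sorry`); (C1′₂) — Kato's `ZetaBody` family for
`P.f` at the conductor level with R-κ, the (Λ)-clauses and acc6's TWO-EXPONENT riders RIDER₂ at torsion slot
`1` and ONE defect exponent `e` — enters as the displayed HYPOTHESIS `hC1` (never obtained: it is crux 19560's
debt class (C1) with the rider read at exponent `1` and the dictionary at defect exponent `e`); the published
inputs [S24] Thm 4.4 (1)(2), GZK, Poitou–Tate are DISPLAYED by name; nothing asserted, nothing booked; 19560 /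
19599 / 19077 / 19679 stay OPEN; BSD is not proved by any of this.  Sequel of
`KimAtThreeShallowEqDeepMultTwoExpPort` (the engine); gen 8's `KimAtThreeShallowEqDeepPortNonAddFineKato`
TOKEN FOR TOKEN with (C1′) ↦ (C1′₂) and the one-exponent port ↦ the two-exponent port at `e`.

## Why `e`
At a split-multiplicative `3` with `3^v ∥ c₃` and `E(ℚ₃)[3] = 0` the dual-exponential lattice is `3^{v−1}ℤ₃`
(Tate curve), so (C1′) (defect exponent `0`) is FALSE there for Kato's system while (C1′₂) holds with `e = v`;
at every other non-additive non-anomalous `t = 0` row (C1′₂) holds with `e = 0` and specialises to (C1′).  The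
exponent `e` cancels in the END argument (acc6's `KimAtThreeTwoExponentAssembly`; gen 7 PortRows at exponent `e`),
so the package quantifies `∃ e` and displays no `c₃`.

## What
* §1 `portUnlockedTwoExp_of_fineKato₁₂_of_nonanomalous` — the UNLOCKED two-exponent port (gen 7 PortRows'
  `hPort` at `(0, e)`) at `(W, v₃, η, P)` for EVERY generator family `η` ⟸ surj(3) ∧ `#E(ℚ₃)[3] = 1` ∧
  `3 ∤ 3 + 𝟙_{3∤N} − a₃` ∧ (C1′₂) — certificates by gen 8's `certSupply_row_nonAdd`, `ht0` by transport
  `ℚ_[3] ≃ ℚ_w`, instance binders discharged; concluded as `∃ e, PORT`.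
* §2 `shallowEqDeep_row_of_fineKato₁₂_of_nonanomalous` — 19599 / 19077's conclusion `∂^{(∞)}_deep(δ̃) ≤ ∂^{(∞)}(δ̃)`
  AT such a tower row with the datum at the conductor; `leaf_row_…` (the LEAF `N11.KimAtThreeRankZeroPUB` at the
  row); `lower_row_…` (19679 / 19075's conclusion) — gen 7 PortRows.
READING (08-28): on the MULTIPLICATIVE `t = 0` tower rows of W2 — split with `3 ∣ c₃` included — shallow = deep,
the LEAF row and the lower row follow from PUB + ONE displayed construction object (C1′₂); together with gen 9's
(C1_τ) on the good rows, EVERY non-additive `t = 0` row of 19599 / 19077 rests on the (C1)-family.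
References: [Kato2004Asterisque] (8.1.3), §6.2, Thm. 6.6 (1), §9.4, Thm. 9.7, Ex. 13.3; [Kim2022StructureSelmer]
§3.2.3, Lemma 3.3, Thm. 3.13, Thm. 1.9 (6); [Kim2025RefinedTNC] Thm 1.1/1.2, §8.1.2; [MazurRubin2004] Thm. 3.2.4,
4.4.1, 5.2.12, App. A; [Sakamoto2024] Thm. 4.4; [Manin1972] Prop. 1.4, Thm. 1.6; memo HOME/w2c4/W2C4-MULT-TWOEXP-g10.md.
-/

set_option autoImplicit false
-- the Theorems namespace of a single-conjunct summit repeats the summit name by design (D-0017)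
set_option linter.dupNamespace false

noncomputable section

open scoped NumberField TensorProduct ContRepresentation Classical
open CategoryTheory Field Function Finset IsDedekindDomain NumberField WeierstrassCurve
open Rat.HeightOneSpectrum
open Literature.NumberTheory.GaloisRepresentations Literature.NumberTheory.GaloisCohomology
open Literature.NumberTheory.GaloisRepresentations.DiscreteGaloisModule
open Literature.NumberTheory.EllipticCurves Literature.NumberTheory.EllipticCurves.ModularForms
open Literature.NumberTheory.EllipticCurves.Rank1Residual
open Literature.NumberTheory.EllipticCurves.Kato2004
open Literature.NumberTheory.EllipticCurves.Kato2004.EulerSystemValues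
open Summit.BirchSwinnertonDyer.Rank1Residual.GaloisImage
open Summit.BirchSwinnertonDyer.BirchSwinnertonDyer.Theorems
open Summit.BirchSwinnertonDyer.BirchSwinnertonDyer.Theorems.KimAtThreeKolyvaginDefs
open Summit.BirchSwinnertonDyer.BirchSwinnertonDyer.Theorems.KimAtThreeShallowEqDeepCertSupplyNonAdd
open Summit.BirchSwinnertonDyer.BirchSwinnertonDyer.Theorems.KimAtThreeShallowEqDeepMultTwoExpPort

namespace Summit.BirchSwinnertonDyer.BirchSwinnertonDyer.Theorems.KimAtThreeShallowEqDeepMultTwoExpFineKato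

/-- Local notation: the TWO-EXPONENT rider clause (ii₂) at depth `j`, torsion slot `t`, defect exponent `e`,
place `v`, for the pair `(Λ, Λf)` (seat acc6's RIDER₂, VERBATIM). -/
local notation3 (prettyPrint := false) "RIDER₂⟦" W' ", " j ", " t' ", " e' ", " v' ", " Λ' ", " Λf "⟧" =>
  ∀ (r : Finset (HeightOneSpectrum (𝓞 ℚ)))
    (Ψ : H1 (tateRep W' 3) (cycSubgroup 3 0 r) →+
      continuousCohomology 1
        (subgroupRep (WeierstrassCurve.torsionGaloisModule W' (((3 : ℕ) : ℤ) ^ j * ((3 : ℕ) : ℤ))).toTopRep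
          (cycSubgroup 3 0 r))),
    (∀ (φ : contOneCocycles (subgroupRep (tateRep W' 3).toTopRep (cycSubgroup 3 0 r)))
        (ψ : contOneCocycles
          (subgroupRep (WeierstrassCurve.torsionGaloisModule W' (((3 : ℕ) : ℤ) ^ j * ((3 : ℕ) : ℤ))).toTopRep
            (cycSubgroup 3 0 r))),
        (∀ g, ((ψ.1 g : geomTorsion W' (((3 : ℕ) : ℤ) ^ j * ((3 : ℕ) : ℤ))) : geomPoints W') =
          TateModule.proj 3 (j + 1) (φ.1 g)) →
        Ψ (oneCocycleClass _ φ) = oneCocycleClass _ ψ) →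
    ∀ (y : H1 (tateRep W' 3) (cycSubgroup 3 0 r))
      (κ₀ : galoisCohomology (WeierstrassCurve.torsionGaloisModule W' (((3 : ℕ) : ℤ) ^ j * ((3 : ℕ) : ℤ))) 1)
      (s : ℤ_[3]),
      resSubgroup (WeierstrassCurve.torsionGaloisModule W' (((3 : ℕ) : ℤ) ^ j * ((3 : ℕ) : ℤ))).toTopRep
          (cycSubgroup 3 0 r) 1 κ₀ = Ψ y →
      galoisCohomology.localization (WeierstrassCurve.torsionGaloisModule W' (((3 : ℕ) : ℤ) ^ j * ((3 : ℕ) : ℤ)))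
          (Sum.inr v') 1 κ₀ ∈ propagatedSelmerStructure W' 3 j (Sum.inr v') →
      (∃ l ∈ cycIntLattice 3 (cycLevel 3 0 r),
          (((3 : ℕ) : ℤ_[3]) ^ t') • Λ' 0 r y - ((s : ℚ_[3]) ⊗ₜ[ℚ] (1 : CyclotomicField (cycLevel 3 0 r) ℚ)) =
            (((3 : ℕ) : ℤ_[3]) ^ (j + 1)) • (l : ℚ_[3] ⊗[ℚ] CyclotomicField (cycLevel 3 0 r) ℚ)) →
      ((3 ^ e' : ℕ) : ZMod (3 ^ (j + 1))) *
        Λf (galoisCohomology.localization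
          (WeierstrassCurve.torsionGaloisModule W' (((3 : ℕ) : ℤ) ^ j * ((3 : ℕ) : ℤ))) (Sum.inr v') 1 κ₀) =
        PadicInt.toZModPow (j + 1) s

/-- Local notation: **(C1′₂) the FINE KATO PACKAGE with the two-exponent riders at torsion slot `1`** AT THE
ROW `(W, v, P)` — Kato's `ZetaBody` family for `P.f` with R-κ, the (Λ)-clauses and RIDER₂ at `(1, e)` for ONE
`e` (the Tate-module instance binders universally quantified so the package is stated instance-free). -/
local notation3 (prettyPrint := false) "FINEKATO₁₂⟦" W' ", " v' ", " N' ", " P' "⟧" =>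
  ∀ [ContinuousSMul ℤ_[3] (WeierstrassCurve.tateModule W' 3)] [Module.Free ℤ_[3] (WeierstrassCurve.tateModule W' 3)]
    [Module.Finite ℤ_[3] (WeierstrassCurve.tateModule W' 3)],
    ∃ (ι : (n : ℕ) → (CyclotomicField n ℚ →+* ℂ)) (κK : ℝ)
      (Λ : ∀ (k' : ℕ) (r : Finset (HeightOneSpectrum (𝓞 ℚ))),
        H1 (tateRep W' 3) (cycSubgroup 3 k' r) →ₗ[ℤ_[3]]
          ℚ_[3] ⊗[ℚ] CyclotomicField (cycLevel 3 k' r) ℚ)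
      (Λfin : ∀ j : ℕ, galoisCohomology
        ((WeierstrassCurve.torsionGaloisModule W' (((3 : ℕ) : ℤ) ^ j * ((3 : ℕ) : ℤ))).toLocal (Sum.inr v')) 1 →+
          ZMod (3 ^ (j + 1))) (e : ℕ),
      κK ≠ 0 ∧ (∃ u : ℚ, (u : ℝ) = κK ∧ padicValRat 3 u = 0) ∧
      (∀ j : ℕ,
        (∀ c : ZMod (3 ^ (j + 1)), ∃ x ∈ propagatedSelmerStructure W' 3 j (Sum.inr v'), Λfin j x = c) ∧
        (∀ x ∈ propagatedSelmerStructure W' 3 j (Sum.inr v'),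
          Λfin j x = 0 ↔ x ∈ WeierstrassCurve.kummerSelmerStructure W' (((3 : ℕ) : ℤ) ^ j * ((3 : ℕ) : ℤ)) (Sum.inr v'))) ∧
      (∀ j : ℕ, RIDER₂⟦W', j, 1, e, v', Λ, Λfin j⟧) ∧
      ∀ (c d a : ℤ) (A : ℕ), 0 < A → Int.gcd c (6 * 3 * A) = 1 → Int.gcd d (6 * 3 * N') = 1 →
        ∃ (z : ∀ (k' : ℕ) (r : (cyclotomicLevelsRat 3 (badPlaces c d A N')).Ideals),
              H1 (tateRep W' 3) ((cyclotomicLevelsRat 3 (badPlaces c d A N')).level k' r.1))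
          (x : ∀ (k' : ℕ) (r : (cyclotomicLevelsRat 3 (badPlaces c d A N')).Ideals),
              CyclotomicField (cycLevel 3 k' r.1) ℚ),
          ZetaBody W' 3 (P' : ModularParametrizationData W' N').f ι κK Λ c d a A z x

/-- Local notation: the UNLOCKED two-exponent port at `(W, v₃, η, P)`, torsion slot `0`, defect exponent `e`
(gen 7 PortRows' `hPort`, VERBATIM). -/
local notation3 (prettyPrint := false) "PORTU₂⟦" W' ", " e' ", " v' ", " η' ", " P' "⟧" =>
  ∀ (k k' : ℕ) (Dk : KolyvaginDatum (WeierstrassCurve.torsionGaloisModule W' (((3 : ℕ) : ℤ) ^ k * ((3 : ℕ) : ℤ))))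
    (Dk' : KolyvaginDatum (WeierstrassCurve.torsionGaloisModule W' (((3 : ℕ) : ℤ) ^ k' * ((3 : ℕ) : ℤ))))
    (red : (WeierstrassCurve.torsionGaloisModule W' (((3 : ℕ) : ℤ) ^ k' * ((3 : ℕ) : ℤ))).toContRepresentation →ⁱL
      (WeierstrassCurve.torsionGaloisModule W' (((3 : ℕ) : ℤ) ^ k * ((3 : ℕ) : ℤ))).toContRepresentation),
    Dk.IsCanonicalTauDatumThreeAtWith W' k k η' → Dk'.IsCanonicalTauDatumThreeAtWith W' k' k' η' → k ≤ k' →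
    (∀ x : geomTorsion W' (((3 : ℕ) : ℤ) ^ k' * ((3 : ℕ) : ℤ)),
      ((red x : geomTorsion W' (((3 : ℕ) : ℤ) ^ k * ((3 : ℕ) : ℤ))) : geomPoints W') =
        (((3 : ℕ) : ℤ) ^ (k' - k)) • (x : geomPoints W')) →
    ∃ κ Λ κ' κu Λu κu',
      KatoKuriharaWitnessAtTwoExp W' k 0 e' Dk v' P' κ Λ κ' ∧
      KatoKuriharaWitnessAtTwoExp W' k' 0 e' Dk' v' P' κu Λu κu' ∧
      ∀ d, Dk'.IsLevel d → Dk.IsLevel d →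
        galoisCohomology.map red 1 (κu d) = κ d ∧ galoisCohomology.map red 1 (κu' d) = κ' d

/-! ### §1 The unlocked two-exponent port at a non-additive non-anomalous `t = 0` row from (C1′₂) alone -/

section Row

variable (W : WeierstrassCurve ℚ) [W.IsElliptic] [W.IsGloballyMinimal]

set_option backward.isDefEq.respectTransparency false in
/-- **The UNLOCKED two-exponent Kato–Kurihara port at a NON-ADDITIVE non-anomalous `t = 0` row — split
multiplicative `3 ∣ c₃` INCLUDED — FROM (C1′₂) ALONE.**  Displayed: the parametrisation datum `P` at the
conductor level (`hN`), surj(3), the place `v₃ ∣ 3`, `#E(ℚ₃)[3] = 1` (the cruxes' `t = 0` binder verbatim), the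
non-anomaly certificate `3 ∤ 3 + 𝟙_{3∤N} − a₃(f)` (`#Ẽ(𝔽₃)` at a good `3`, `3 ∓ 1` at a multiplicative `3` —
automatic there), and (C1′₂) at the row.  Inside: the Tate-module instance binders
(`TateModule.continuousSMul_padicInt`, `module_free/finite_tateModule_holds`), the auxiliary cusp datum with its
certificates from gen 8's `certSupply_row_nonAdd`, `ht0` by transport `ℚ_[3] ≃ ℚ_w` (`LocalTorsion3`), the
witnesses from (C1′₂), the port by `katoKuriharaPortUnlockedTwoExp_zero_of_zetaBody_nonAdd_of_unramified`.
Concluded: `∃ e`, the unlocked two-exponent port at `(W, v₃, η, P)` for EVERY generator family `η` — gen 7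
PortSeam's `hPortOff` text at the row.  Nothing asserted; nothing booked.
[cite: Kato2004Asterisque, (8.1.3) (p. 180), §9.4 (p. 188), Thm. 9.7 (p. 189), Thm. 6.6 (1) (p. 163) and Ex. 13.3 (pp. 224–225)]
[cite: Kim2022StructureSelmer, §3.2.3, Lemma 3.3 and Thm. 3.13 (arXiv v3 pp. 16–18, 26–28)]
[cite: MazurRubin2004, Thm. 3.2.4 and App. A (Lemma A.1, Remark A.5)] [cite: Manin1972, Prop. 1.4, Thm. 1.6] -/
theorem portUnlockedTwoExp_of_fineKato₁₂_of_nonanomalous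
    {N : ℕ} [NeZero N] (P : ModularParametrizationData W N) (hN : N = W.conductorNorm ℤ)
    (hsurj : W.HasSurjectiveModNGaloisRep ((3 : ℕ) : ℤ))
    {v₃ : HeightOneSpectrum (𝓞 ℚ)} (hv₃ : ((3 : ℕ) : 𝓞 ℚ) ∈ v₃.asIdeal)
    (ht : Nat.card {Q : (W.baseChange ℚ_[3]).toAffine.Point // (3 : ℕ) • Q = 0} = 1)
    {t₃ : ℤ} (ht₃ : cuspCoeff P.f 3 = t₃) (h3a : ¬ (3 : ℤ) ∣ 3 + (if 3 ∣ N then 0 else 1) - t₃)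
    (hC1 : FINEKATO₁₂⟦W, v₃, N, P⟧)
    (η : (q : HeightOneSpectrum (𝓞 ℚ)) → (ZMod (Ideal.absNorm q.asIdeal))ˣ) :
    ∃ e : ℕ, PORTU₂⟦W, e, v₃, η, P⟧ := by
  haveI : ContinuousSMul ℤ_[3] (W.tateModule 3) := TateModule.continuousSMul_padicInt
  haveI : Module.Free ℤ_[3] (W.tateModule 3) := W.module_free_tateModule_holds 3
  haveI : Module.Finite ℤ_[3] (W.tateModule 3) := W.module_finite_tateModule_holds 3
  obtain ⟨ι, κK, Λ, Λfin, e, hκ0, hNorm, hΛ, hfin₂, hz⟩ := hC1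
  obtain ⟨c, d, a, A, d', aM, hA, hcA, hdN, hcdA, hcd, hdd', hAN, haM, hE0, hE, hR0, hR⟩ :=
    certSupply_row_nonAdd W (by simpa using hsurj) P ht₃ h3a
  haveI : NeZero A := ⟨hA.ne'⟩
  obtain ⟨z, x, hbody⟩ := hz c d a A hA hcA hdN
  -- THEOREM D-u's certificate `ht0` from `#E(ℚ₃)[3] = 1` (transport `ℚ_[3] ≃ ℚ_w`, as in kim3's p448445)
  have ht0 : ∀ w : HeightOneSpectrum (𝓞 ℚ), ((3 : ℕ) : 𝓞 ℚ) ∈ w.asIdeal →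
      ∀ Q : (W.baseChange (w.adicCompletion ℚ)).toAffine.Point, 3 • Q = 0 → Q = 0 := by
    intro w hw Q hQ
    have hw3 : ((primesEquiv w : Nat.Primes) : ℕ) = 3 := primesEquiv_eq_of_natCast_mem Nat.prime_three hw
    have hker := LocalTorsion3.natCard_ker_nsmul_adicCompletion_eq_natCard_torsion_padic W w hw3 3
    rw [ht] at hker
    have hbot := (AddSubgroup.card_eq_one).mp hker
    have hmem : Q ∈ (nsmulAddMonoidHom 3 : (W.baseChange (w.adicCompletion ℚ)).toAffine.Point →+
        (W.baseChange (w.adicCompletion ℚ)).toAffine.Point).ker := by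
      rw [AddMonoidHom.mem_ker, nsmulAddMonoidHom_apply]
      exact hQ
    rw [hbot] at hmem
    exact (AddSubgroup.mem_bot).mp hmem
  exact ⟨e, katoKuriharaPortUnlockedTwoExp_zero_of_zetaBody_nonAdd_of_unramified W P hN hbody hNorm hκ0 d' hcd
    hdd' hAN aM haM hE0 hE hR0 hR hv₃ hsurj Λfin hΛ hfin₂ hcdA ht0⟩

end Row

/-! ### §2 The row conclusions of W2 there -/

section Rows

variable (W : WeierstrassCurve ℚ) [W.IsElliptic] [W.IsGloballyMinimal]

/-- **SHALLOW = DEEP — the conclusion of cruxes 19599 `ShallowEqDeepOffKatoStratum` / 19077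
`ShallowEqDeepAtTorsionFree` — AT a NON-ADDITIVE non-anomalous `t = 0` TOWER ROW (split multiplicative `3 ∣ c₃`
included) with the datum at the conductor, FROM PUB + (C1′₂) ALONE**: `∂^{(∞)}_deep(δ̃) ≤ ∂^{(∞)}(δ̃)` for `D.f`,
from [S24] Thm 4.4 (1)(2), GZK, Poitou–Tate (by name), the `3`-adic tower, `#E(ℚ₃)[3] = 1`, `3`-integral plus
symbols, `ord(δ̃) = 0`, a place `v₃ ∣ 3`, one generator family `η`, the non-anomaly certificate and (C1′₂) for
`D.f`.  Gen 7's `KimAtThreeShallowEqDeepPortRows.shallowEqDeep_row_of_portUnlocked` at the exponent `e` of §1.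
No `Addv`, no `c₃`, no `9 ∣ N`, no Manin constant, no period transfer, no `hbad`, no auxiliary datum displayed.
Nothing booked. [cite: Kim2025RefinedTNC, Thm 1.2] [cite: Kim2022StructureSelmer, Thm. 1.9 (6), §3.2.3, Thm. 3.13]
[cite: Sakamoto2024, Thm. 4.4 (p. 926)] [cite: MazurRubin2004, Thm. 5.2.12] [cite: Kato2004Asterisque, Thm. 9.7 (p. 189)] -/
theorem shallowEqDeep_row_of_fineKato₁₂_of_nonanomalous
    (hS24 : Sakamoto2024.kolyvaginSystems_freeRankOne_zmod_three_pow)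
    (hS24₂ : Sakamoto2024.kolyvaginSystems_idealOfBasis_eq_fittingIdeal_zmod_three_pow)
    (hGZK : rank_eq_analyticRank_of_analyticRank_le_one) (hPT : poitouTate_selmerStructure_duality ℚ)
    (htower : ∀ m : ℕ, W.HasSurjectiveModNGaloisRep (3 ^ m : ℕ))
    (ht : Nat.card {Q : (W.baseChange ℚ_[3]).toAffine.Point // (3 : ℕ) • Q = 0} = 1)
    {N : ℕ} [NeZero N] (D : ModularParametrizationData W N) (hN : N = W.conductorNorm ℤ)
    (hint : ∀ r : ℚ, ratPlusSymbol D.f r ≠ 0 → 0 ≤ padicValRat 3 (ratPlusSymbol D.f r))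
    (hord : kuriharaVanishingOrder W 3 D.f = 0)
    (v₃ : HeightOneSpectrum (𝓞 ℚ)) (hv₃ : ((3 : ℕ) : 𝓞 ℚ) ∈ v₃.asIdeal)
    (η : (q : HeightOneSpectrum (𝓞 ℚ)) → (ZMod (Ideal.absNorm q.asIdeal))ˣ)
    (hη : ∀ q : HeightOneSpectrum (𝓞 ℚ), Subgroup.zpowers (η q) = ⊤)
    {t₃ : ℤ} (ht₃ : cuspCoeff D.f 3 = t₃) (h3a : ¬ (3 : ℤ) ∣ 3 + (if 3 ∣ N then 0 else 1) - t₃)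
    (hC1 : FINEKATO₁₂⟦W, v₃, N, D⟧) :
    kuriharaPartialDeepInfty W 3 D.f ≤ kuriharaPartialInfty W 3 D.f := by
  obtain ⟨e, hPort⟩ :=
    portUnlockedTwoExp_of_fineKato₁₂_of_nonanomalous W D hN (by simpa using htower 1) hv₃ ht ht₃ h3a hC1 η
  exact KimAtThreeShallowEqDeepPortRows.shallowEqDeep_row_of_portUnlocked hS24 hS24₂ hGZK hPT W htower D e hint
    hord v₃ hv₃ η hη hPort hN

/-- **The LEAF row (`N11.KimAtThreeRankZeroPUB` at the row = Kim's clause (6) at `p = 3`): `∃ d, ∂^{(∞)} = d ∧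
∂⁽⁰⁾ = ord₃ #Ш(3) + d` AT a NON-ADDITIVE non-anomalous `t = 0` TOWER ROW with the datum at the conductor, FROM
PUB + (C1′₂) ALONE** — same displayed inputs as `shallowEqDeep_row_of_fineKato₁₂_of_nonanomalous`; gen 7's
`KimAtThreeShallowEqDeepPortRows.leaf_row_of_portUnlocked` at the exponent of §1.  Nothing booked; BSD is not
proved by this. [cite: Kim2025RefinedTNC, Thm 1.1] [cite: Kim2022StructureSelmer, Thm. 1.9 (6)]
[cite: Sakamoto2024, Thm. 4.4 (p. 926)] [cite: MazurRubin2004, Thm. 4.4.1 and Thm. 5.2.12] -/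
theorem leaf_row_of_fineKato₁₂_of_nonanomalous
    (hS24 : Sakamoto2024.kolyvaginSystems_freeRankOne_zmod_three_pow)
    (hS24₂ : Sakamoto2024.kolyvaginSystems_idealOfBasis_eq_fittingIdeal_zmod_three_pow)
    (hGZK : rank_eq_analyticRank_of_analyticRank_le_one) (hPT : poitouTate_selmerStructure_duality ℚ)
    (htower : ∀ m : ℕ, W.HasSurjectiveModNGaloisRep (3 ^ m : ℕ))
    (ht : Nat.card {Q : (W.baseChange ℚ_[3]).toAffine.Point // (3 : ℕ) • Q = 0} = 1)
    {N : ℕ} [NeZero N] (D : ModularParametrizationData W N) (hN : N = W.conductorNorm ℤ)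
    (hint : ∀ r : ℚ, ratPlusSymbol D.f r ≠ 0 → 0 ≤ padicValRat 3 (ratPlusSymbol D.f r))
    (hord : kuriharaVanishingOrder W 3 D.f = 0)
    (v₃ : HeightOneSpectrum (𝓞 ℚ)) (hv₃ : ((3 : ℕ) : 𝓞 ℚ) ∈ v₃.asIdeal)
    (η : (q : HeightOneSpectrum (𝓞 ℚ)) → (ZMod (Ideal.absNorm q.asIdeal))ˣ)
    (hη : ∀ q : HeightOneSpectrum (𝓞 ℚ), Subgroup.zpowers (η q) = ⊤)
    {t₃ : ℤ} (ht₃ : cuspCoeff D.f 3 = t₃) (h3a : ¬ (3 : ℤ) ∣ 3 + (if 3 ∣ N then 0 else 1) - t₃)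
    (hC1 : FINEKATO₁₂⟦W, v₃, N, D⟧) :
    ∃ dd : ℕ, kuriharaPartialInfty W 3 D.f = dd ∧
      kuriharaPartial W 3 D.f 0 =
        ((padicValNat 3 (Nat.card (AddCommGroup.primaryComponent W.sha 3)) + dd : ℕ) : ℕ∞) := by
  obtain ⟨e, hPort⟩ :=
    portUnlockedTwoExp_of_fineKato₁₂_of_nonanomalous W D hN (by simpa using htower 1) hv₃ ht ht₃ h3a hC1 η
  exact KimAtThreeShallowEqDeepPortRows.leaf_row_of_portUnlocked hS24 hS24₂ hGZK hPT W htower D e hint hord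
    v₃ hv₃ η hη hPort hN

/-- **The LOWER row — the conclusion of cruxes 19679 `DeepLowerAtThreeOffKatoStratum` / 19075 `DeepLowerAtThree`:
`∃ d, ∂^{(∞)}_deep = d ∧ ∂⁽⁰⁾ ≤ ord₃ #Ш(3) + d` — AT a NON-ADDITIVE non-anomalous `t = 0` TOWER ROW (split
multiplicative `3 ∣ c₃` included) with the datum at the conductor, FROM PUB + (C1′₂) ALONE** — same displayed
inputs; gen 7's `KimAtThreeShallowEqDeepPortRows.lower_row_of_portUnlocked` at the exponent of §1.  Nothing
booked; BSD is not proved by this. [cite: Kim2022StructureSelmer, Thm. 1.9 (6), §1.5.1]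
[cite: MazurRubin2004, Def. 5.2.11, Thm. 5.2.12 (i)] [cite: Sakamoto2024, Thm. 4.4 (p. 926)] -/
theorem lower_row_of_fineKato₁₂_of_nonanomalous
    (hS24 : Sakamoto2024.kolyvaginSystems_freeRankOne_zmod_three_pow)
    (hS24₂ : Sakamoto2024.kolyvaginSystems_idealOfBasis_eq_fittingIdeal_zmod_three_pow)
    (hGZK : rank_eq_analyticRank_of_analyticRank_le_one) (hPT : poitouTate_selmerStructure_duality ℚ)
    (htower : ∀ m : ℕ, W.HasSurjectiveModNGaloisRep (3 ^ m : ℕ))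
    (ht : Nat.card {Q : (W.baseChange ℚ_[3]).toAffine.Point // (3 : ℕ) • Q = 0} = 1)
    {N : ℕ} [NeZero N] (D : ModularParametrizationData W N) (hN : N = W.conductorNorm ℤ)
    (hint : ∀ r : ℚ, ratPlusSymbol D.f r ≠ 0 → 0 ≤ padicValRat 3 (ratPlusSymbol D.f r))
    (hord : kuriharaVanishingOrder W 3 D.f = 0)
    (v₃ : HeightOneSpectrum (𝓞 ℚ)) (hv₃ : ((3 : ℕ) : 𝓞 ℚ) ∈ v₃.asIdeal)
    (η : (q : HeightOneSpectrum (𝓞 ℚ)) → (ZMod (Ideal.absNorm q.asIdeal))ˣ)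
    (hη : ∀ q : HeightOneSpectrum (𝓞 ℚ), Subgroup.zpowers (η q) = ⊤)
    {t₃ : ℤ} (ht₃ : cuspCoeff D.f 3 = t₃) (h3a : ¬ (3 : ℤ) ∣ 3 + (if 3 ∣ N then 0 else 1) - t₃)
    (hC1 : FINEKATO₁₂⟦W, v₃, N, D⟧) :
    ∃ dd : ℕ, kuriharaPartialDeepInfty W 3 D.f = dd ∧
      kuriharaPartial W 3 D.f 0 ≤
        ((padicValNat 3 (Nat.card (AddCommGroup.primaryComponent W.sha 3)) + dd : ℕ) : ℕ∞) := by
  obtain ⟨e, hPort⟩ :=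
    portUnlockedTwoExp_of_fineKato₁₂_of_nonanomalous W D hN (by simpa using htower 1) hv₃ ht ht₃ h3a hC1 η
  exact KimAtThreeShallowEqDeepPortRows.lower_row_of_portUnlocked hS24 hS24₂ hGZK hPT W htower D e hint hord
    v₃ hv₃ η hη hPort hN

end Rows

end Summit.BirchSwinnertonDyer.BirchSwinnertonDyer.Theorems.KimAtThreeShallowEqDeepMultTwoExpFineKato

end
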